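import Literature.AlgebraicGeometry.Motives.MotivatedCycles
import Literature.AlgebraicGeometry.Motives.LefschetzStarProofs
import Literature.AlgebraicGeometry.Motives.CorrespondencesTransposeProofs
import Literature.AlgebraicGeometry.Motives.VarietiesProjectiveSpaceProofs
import Literature.AlgebraicGeometry.Motives.WeilCohomologyProofs
import HarnessLib

/-!
# Motivated cycles: algebraic classes are motivated (proofs)

This file discharges the named fact
`Literature.AlgebraicGeometry.Motives.WeilCohomology.algebraicClasses_le_motivatedClasses` of
`Literature.AlgebraicGeometry.Motives.MotivatedCycles`: for a Weil cohomology theory `W` with the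
hard Lefschetz property and `X` smooth projective of dimension `n`, the `K`-span `Aᵖ(X)` of the
algebraic classes is contained in the space `A_mot^p(X)` of motivated classes,
`W.algebraicClasses X p ≤ W.motivatedClasses n X p` (Y. André, *Pour une théorie inconditionnelle
des motifs*, Publ. Math. IHÉS 83 (1996), §2.1, the remark following Définition 1, p. 14 of the
journal (p. 11 of the offprint): «Il est clair que `A_mot(X)_E` contient `A(X)` et `⋆A(X)`
(prendre `α` ou `β` égal à la classe fondamentale de `X × Y`)»; Prop. 2.1 (i) ibid. is the
statement that `A_mot(X)_E` is a sub-`E`-algebra of `H•(X)` for the cup product).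

## Proof

André's definition (Déf. 1, vendored as `WeilCohomology.IsMotivatedClass`) allows an arbitrary
auxiliary smooth projective `Y`; the vendored relational form asks for a hyperplane class `η` on
`X × Y` with a Lefschetz involution `⋆`, rational algebraic classes `α`, `β` on `X × Y`, and the
projection formula `tr_X (x ∪ y) = tr_{X×Y} ((α ∪ ⋆β) ∪ pr_X* y)` for all `y`. We take
`Y = ℙ¹` (rather than a point, so that `X × Y` has positive dimension and carries a hyperplane
class by the axiom `isHyperplaneClass_nonempty` even when `dim X = 0`), `β = η^{n+1}` — for which
`⋆β = 1` by Kleiman's normalisation `⋆ (Lʲ x) = (-1)^{i(i+1)/2} Lⁿ⁻ⁱ⁻ʲ x` applied to the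
primitive class `x = 1 ∈ H⁰` (`isLefschetzStar_apply_pow`) — and
`α = d⁻¹ · (pr_X* x ∪ pr_{ℙ¹}* η₁)` where `η₁` is a hyperplane class on `ℙ¹` of degree
`d = tr_{ℙ¹} η₁ > 0` (axiom `trace_pow_of_isHyperplaneClass`). Then
`tr_{X×ℙ¹} ((α ∪ 1) ∪ pr_X* y) = d⁻¹ tr_{X×ℙ¹} (pr_X* (x ∪ y) ∪ pr_{ℙ¹}* η₁) = tr_X (x ∪ y)` by
associativity and graded commutativity of `∪`, multiplicativity of `pr_X*` and of the trace
(axiom (B), `trace_externalCup`). Rational algebraicity of `α`, `β` is the C-lite axioms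
`pullback_ratAlgebraicClasses_le`, `cup_mem_ratAlgebraicClasses` and divisibility of
`A(X × Y)_ℚ`. Products of smooth projective varieties are smooth projective by the discharged
fact `IsSmoothProjective.tensor_holds` (`SegreEmbedding`), `ℙ¹` is smooth projective by
`isSmoothProjective_projectiveSpace_holds`, and `⋆` exists by `WeilCohomology.starOp`
(`LefschetzStarProofs`).

No statement of `MotivatedCycles.lean` is restated or modified; no new named facts.

## Main statements

* `WeilCohomology.isMotivatedClass_of_mem_ratAlgebraicClasses`: every rational algebraic class
  `x ∈ Aᵖ(X)_ℚ` is a motivated class (with auxiliary variety `ℙ¹`).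
* `WeilCohomology.algebraicClasses_le_motivatedClasses_holds`: the discharge.

## References

* Y. André, *Pour une théorie inconditionnelle des motifs*, Publ. Math. IHÉS 83 (1996), 5–49,
  §2.1 (Déf. 1 and the remark following it, p. 14; Prop. 2.1). [Andre1996]
* S. Kleiman, *Algebraic cycles and the Weil conjectures*, in: Dix exposés sur la cohomologie
  des schémas (1968), §1.2, 1.4.2 (normalisation of `⋆`). [Kleiman1968]
-/

universe u v

open CategoryTheory AlgebraicGeometry MonoidalCategory CartesianMonoidalCategory
open scoped TensorProduct

noncomputable section

namespace Literature.AlgebraicGeometry.Motives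

namespace WeilCohomology

variable {k : Type u} [Field k] {K : Type v} [Field K] [CharZero K] (W : WeilCohomology k K)
variable {n : ℕ} {X : SchemeOver k}

/-! ## Rational algebraic classes: divisibility, pull-backs, hyperplane classes, powers -/

/-- `Aᵖ(X)_ℚ` is a `ℚ`-subspace: it is stable under `x ↦ d⁻¹ • x` for `d ≠ 0` (it is the
divisible hull of the algebraic lattice). [folklore] -/
theorem inv_natCast_smul_mem_ratAlgebraicClasses {p : ℕ} {x : W.obj X (2 * p)}
    (hx : x ∈ W.ratAlgebraicClasses X p) {d : ℕ} (hd : d ≠ 0) :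
    (d : K)⁻¹ • x ∈ W.ratAlgebraicClasses X p := by
  obtain ⟨N, hN, hNx⟩ := hx
  have hdK : (d : K) ≠ 0 := Nat.cast_ne_zero.mpr hd
  refine ⟨N * d, mul_ne_zero hN (Int.natCast_ne_zero.mpr hd), ?_⟩
  have h : (N * d : ℤ) • ((d : K)⁻¹ • x) = N • x := by
    rw [mul_smul, ← Int.cast_smul_eq_zsmul K (d : ℤ), Int.cast_natCast, smul_smul,
      mul_inv_cancel₀ hdK, one_smul]
  rw [h]
  exact hNx

/-- Pull-back along a morphism of smooth projective varieties preserves rational algebraic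
classes (pointwise form of the axiom `pullback_ratAlgebraicClasses_le`). [folklore] -/
theorem pullback_mem_ratAlgebraicClasses (hX : IsSmoothProjective n X) {m : ℕ} {Y : SchemeOver k}
    (hY : IsSmoothProjective m Y) (f : X ⟶ Y) {p : ℕ} {y : W.obj Y (2 * p)}
    (hy : y ∈ W.ratAlgebraicClasses Y p) :
    W.pullback f (2 * p) y ∈ W.ratAlgebraicClasses X p :=
  W.pullback_ratAlgebraicClasses_le hX hY f p (AddSubgroup.mem_map_of_mem _ hy)

/-- A hyperplane class `η = ι* cl(D)` (`ι : X ↪ ℙᴺ`, `D` a divisor on `ℙᴺ`) on a smooth projective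
`X` is a rational algebraic class of codimension `1`. [folklore] -/
theorem mem_ratAlgebraicClasses_of_isHyperplaneClass (hX : IsSmoothProjective n X)
    {η : W.obj X 2} (hη : W.IsHyperplaneClass X η) : η ∈ W.ratAlgebraicClasses X 1 := by
  obtain ⟨e, D, hD, -, rfl⟩ := hη
  exact W.pullback_mem_ratAlgebraicClasses hX (isSmoothProjective_projectiveSpace_holds k e.n) e.ι
    (W.algebraicLattice_le_ratAlgebraicClasses _ 1 (W.cycleMap_mem_algebraicLattice _ 1 hD))

/-- Positive powers `ηʳ⁺¹` of a rational algebraic class `η ∈ A¹(X)_ℚ` are rational algebraic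
(axiom `cup_mem_ratAlgebraicClasses`; `η¹ = 1 ∪ η = η`). [folklore] -/
theorem pow_succ_mem_ratAlgebraicClasses (hX : IsSmoothProjective n X) {η : W.obj X 2}
    (hη : η ∈ W.ratAlgebraicClasses X 1) (r : ℕ) :
    W.pow X η (r + 1) ∈ W.ratAlgebraicClasses X (r + 1) := by
  induction r with
  | zero =>
    have h : W.pow X η (0 + 1) = η := W.one_cup hX _ _
    rw [h]
    exact hη
  | succ r ih =>
    rw [PreWeilCohomology.pow_succ]
    exact W.cup_mem_ratAlgebraicClasses hX (p := r + 1) (q := 1) (r := r + 1 + 1) rfl _ _ ih hη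

/-! ## The Lefschetz involution on the top power of the hyperplane class -/

/-- The unit `1 ∈ H⁰(X)` is a primitive class: `Lⁿ⁺¹ 1 ∈ H²ⁿ⁺²(X) = 0`. [folklore] -/
theorem isPrimitive_one (hX : IsSmoothProjective n X) (η : W.obj X 2) :
    W.IsPrimitive n η (W.one X) :=
  ⟨fun h ↦ absurd h (Nat.not_lt_zero n), fun r j h hr ↦ by
    haveI := W.subsingleton_obj hX (i := j) (by omega)
    exact Subsingleton.elim _ _⟩

/-- For a Lefschetz star operator `⋆` of `(X, η)`, `X` of dimension `n`: `⋆ (ηⁿ) = 1`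
(Kleiman 1968 1.4.2 with `x = 1 ∈ P⁰(X)`, `j = n`: `⋆ (Lⁿ 1) = (-1)⁰ L⁰ 1 = 1`). [cite: Kleiman1968, 1.4.2] -/
theorem isLefschetzStar_apply_pow (hX : IsSmoothProjective n X) {η : W.obj X 2}
    {S : W.GradedOp X X} (hS : W.IsLefschetzStar n η S) :
    S (2 * n) (2 * 0) (W.pow X η n) = W.one X := by
  have h := hS.2 0 (W.one X) (W.isPrimitive_one hX η) n 0 (2 * n) (2 * 0) (Nat.zero_add _)
    (Nat.zero_add _) (by omega)
  have h1 : W.lefschetzPow X η n 0 (2 * n) (Nat.zero_add _) (W.one X) = W.pow X η n := by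
    show W.cup _ (W.one X) (W.pow X η n) = _
    exact W.one_cup hX _ _
  have h2 : W.lefschetzPow X η 0 0 (2 * 0) (Nat.zero_add _) (W.one X) = W.one X := by
    show W.cup _ (W.one X) (W.pow X η 0) = _
    exact W.one_cup hX _ _
  rw [h1, h2] at h
  rw [h]
  simp

/-! ## Algebraic classes are motivated -/

/-- **Every rational algebraic class is a motivated class** (André 1996 §2.1, remark after
Déf. 1: `A(X) ⊆ A_mot(X)`), in the vendored relational form `WeilCohomology.IsMotivatedClass`,
with auxiliary variety `Y = ℙ¹`, `β = ηⁿ⁺¹` (`⋆β = 1`) and `α = d⁻¹ · (pr_X* x ∪ pr_{ℙ¹}* η₁)`,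
`η₁` a hyperplane class on `ℙ¹` of degree `d`; see the module docstring. [cite: Andre1996, §2.1, remark after Déf. 1 (p. 14)] -/
theorem isMotivatedClass_of_mem_ratAlgebraicClasses (hL : W.HasHardLefschetz)
    (hX : IsSmoothProjective n X) {p : ℕ} {x : W.obj X (2 * p)}
    (hx : x ∈ W.ratAlgebraicClasses X p) : W.IsMotivatedClass n X p x := by
  obtain ⟨P, hP⟩ : ∃ P : SchemeOver k, IsSmoothProjective 1 P :=
    ⟨projectiveSpace 1 k, isSmoothProjective_projectiveSpace_holds k 1⟩
  have hXP : IsSmoothProjective (n + 1) (X ⊗ P) := IsSmoothProjective.tensor_holds hX hP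
  obtain ⟨η, hη⟩ := W.isHyperplaneClass_nonempty hXP (Nat.le_add_left 1 n)
  obtain ⟨η₁, hη₁⟩ := W.isHyperplaneClass_nonempty hP le_rfl
  obtain ⟨d, hd, hdtr⟩ := W.trace_pow_of_isHyperplaneClass hP η₁ hη₁
  have hdK : (d : K) ≠ 0 := Nat.cast_ne_zero.mpr hd.ne'
  have hpow : W.pow P η₁ 1 = η₁ := W.one_cup hP _ _
  have hη₁tr : W.trace P 1 η₁ = d := by simpa only [hpow] using hdtr
  have hS := W.isLefschetzStar_starOp hL hXP hη
  have h2p1 : 2 * p + 2 * 1 = 2 * (p + 1) := by omega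
  refine ⟨1, P, hP, η, hη, W.starOp hL hXP hη, hS, p + 1, n + 1, 0, rfl, rfl,
    (d : K)⁻¹ • W.externalCup X P h2p1 x η₁, W.pow (X ⊗ P) η (n + 1), ?_, ?_, ?_⟩
  · -- `α = d⁻¹ · (pr_X* x ∪ pr_{ℙ¹}* η₁)` is rational algebraic
    refine W.inv_natCast_smul_mem_ratAlgebraicClasses ?_ hd.ne'
    rw [W.externalCup_apply]
    exact W.cup_mem_ratAlgebraicClasses hXP (p := p) (q := 1) (r := p + 1) rfl _ _
      (W.pullback_mem_ratAlgebraicClasses hXP hX (fst X P) hx)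
      (W.pullback_mem_ratAlgebraicClasses hXP hP (snd X P)
        (W.mem_ratAlgebraicClasses_of_isHyperplaneClass hP hη₁))
  · -- `β = ηⁿ⁺¹` is rational algebraic
    exact W.pow_succ_mem_ratAlgebraicClasses hXP
      (W.mem_ratAlgebraicClasses_of_isHyperplaneClass hXP hη) n
  · -- the projection formula `tr_X (x ∪ y) = tr_{X×ℙ¹} ((α ∪ ⋆β) ∪ pr_X* y)`
    intro q hq y
    have hc1 : W.cup (show 2 * (p + 1) + 2 * 0 = 2 * (p + 1) by omega)
        ((d : K)⁻¹ • W.externalCup X P h2p1 x η₁) (W.one (X ⊗ P)) =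
        (d : K)⁻¹ • W.externalCup X P h2p1 x η₁ :=
      W.cup_one hXP _ _
    have hjl : 2 * 1 + 2 * q = 2 * q + 2 * 1 := by omega
    have hjl' : 2 * q + 2 * 1 = 2 * q + 2 * 1 := rfl
    have H2 : 2 * p + (2 * q + 2 * 1) = 2 * (n + 1) := by omega
    have h₇ : 2 * p + 2 * q = 2 * n := by omega
    have H : 2 * n + 2 * 1 = 2 * (n + 1) := by omega
    rw [W.isLefschetzStar_apply_pow hXP hS, hc1, LinearMap.map_smul₂, map_smul, smul_eq_mul,
      W.externalCup_apply,
      W.cup_assoc hXP h2p1 hjl (show 2 * (p + 1) + 2 * q = 2 * (n + 1) by omega) H2,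
      W.cup_comm_of_even hXP hjl hjl' (Or.inl (even_two_mul 1)) (W.pullback (snd X P) (2 * 1) η₁)
        (W.pullback (fst X P) (2 * q) y),
      ← W.cup_assoc hXP h₇ hjl' H H2, ← W.map_cup hXP hX (fst X P) h₇ x y,
      ← W.externalCup_apply, W.trace_externalCup hX hP, hη₁tr,
      mul_comm _ (d : K), ← mul_assoc, inv_mul_cancel₀ hdK, one_mul]
    rfl

/-- **Discharge of the named fact `WeilCohomology.algebraicClasses_le_motivatedClasses`**
(André 1996 §2.1, remark following Déf. 1, p. 14: «`A_mot(X)_E` contient `A(X)`»; cf.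
Prop. 2.1 (i)): for a Weil cohomology theory with the hard Lefschetz property and `X` smooth
projective of dimension `n`, `Aᵖ(X) ⊆ A_mot^p(X)` as `K`-subspaces of `H²ᵖ(X)`. The span
`Aᵖ(X) = K · (algebraic lattice)` is generated by rational algebraic classes, each of which is a
motivated class (`isMotivatedClass_of_mem_ratAlgebraicClasses`). [cite: Andre1996, §2.1, remark after Déf. 1 (p. 14); Prop. 2.1 (i)] -/
theorem algebraicClasses_le_motivatedClasses_holds : W.algebraicClasses_le_motivatedClasses := by
  intro hL n X hX p
  refine Submodule.span_le.mpr fun x hx ↦ ?_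
  exact (W.isMotivatedClass_of_mem_ratAlgebraicClasses hL hX
    (W.algebraicLattice_le_ratAlgebraicClasses X p hx)).mem_motivatedClasses

end WeilCohomology

end Literature.AlgebraicGeometry.Motives

end
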